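import Literature.Geometry.DiscreteGeometry.ShellCensusTwelve

/-!
# `ShellTrichotomy` (stmt-AtomisticToContinuum-18070), negative side V-a: tools for the load-bearing analysis of
# the combinatorial core of line `Sketch` (witness files V-b `CensusCoreWithoutQCorner`, V-c `CensusCoreWithoutHCorner`)

The picked line `Sketch` (`Cruxes/ShellTrichotomy/Lines/Sketch.lean`, lead prover-line-…-18070-0) reduces the census
half of the crux to an ABSTRACT finite statement `stub_censusCore`: on twelve labels, a symmetric irreflexive
4-regular `bond : Fin 12 → Fin 12 → Bool`, a closed triangulated surface `tri` of twenty triples (two triangles per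
side, bonds are sides, bonded 3-cliques are triangles, flag-connected links) and angles `ang S v ≥ 0` with node sums
`2π` and the three corner bounds `T ≤ arccos (1/4)`, `H ≤ arccos (807/2000)`, `Q ≤ 2·arccos (807/2000)` force the
bond graph to be the cuboctahedral, the anticuboctahedral or the hexagonal-antiprism graph.

Disprover's findings (seat refuter-cdisprove-stmt-AtomisticToContinuum-18070-0, 2026-08-17; enumeration
`compute/census_core/job.py`, attached as evidence on the crux item: all 7595 triangulations of the sphere with twelve
vertices — level counts `1,1,2,5,14,50,233,1249,7595` = OEIS A000109 and `130` of minimum degree `≥ 4` = plantri,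
certifying completeness — all `723` pairs `(tri, bond)`, exact dead-vertex rule):

* the finite content of `stub_censusCore` HOLDS (62 surviving pairs, all cubo / anticubo / antiprism; the angle LP
  decouples per vertex, the only dead vertex types are `4T`, `3T+Q` and `3T+2H`; the non-sphere surface
  `RP²₆ ⊔ RP²₆` admitted by the abstract hypotheses dies by `bond_tri`);
* but BOTH quadrilateral-corner hypotheses are load-bearing, which the two witness files prove in the kernel:
  `stub_censusCore_false_without_qCorner` and `stub_censusCore_false_without_hCorner` — the core with the `Q`-corner
  (resp. the `H`-corner) bound deleted, everything else verbatim, is FALSE.  Witnesses: a `(9,4,1)` four-regular plane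
  map (nine bonded triangles, so not one of the three targets, which have `8, 8, 12`: `cliqueCount_relabel`) inside an
  explicit sphere triangulation whose quad diagonals avoid (resp. pass through) the `3T+Q` vertices, with an explicit
  rational angle table (`T = 72°`, `H ≤ 60°`, `Q ≤ 120°`, free corners absorbing the rest; `2π/5 ≤ arccos (1/4)` by
  `cos (2π/5) = (√5-1)/4`, `π/3 ≤ arccos (807/2000)` by `cos (π/3) = 1/2`).
* numerically load-bearing as well (same enumeration, not formalised): the T-corner constant must beat
  `(360° − 2·arccos (807/2000))/3 = 75.865°` (the coupled bound `arccos (1/4) = 75.52°` does, the decoupled corner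
  maximum `76.3°` does not: with `T ≤ 76.35°` six exotic maps survive); `bond_tri` is NOT needed by the core (the two
  pairs violating it die anyway).

This file: `cliqueCount` / `cliqueCount_relabel` (bonded 3-cliques are relabelling-invariant), `no_target_of_cliqueCount`
(a bond relation with clique count `∉ {8, 12}` matches none of the three labelled targets), `forall_mem_of_forall_getD` and
`link_of_chain` (flag-connected links from explicit chains — index-quantified, because a bare `∀ S ∈ l` over
`Finset (Fin 12)` makes `decide` enumerate all 4096 label sets through `Fintype`), `triKey`, and the brackets
`2π/5 ≤ arccos (1/4)`, `π/3 ≤ arccos (807/2000)`.  Negative-side support for the crux item (no route statement is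
concluded positively); the lead may import these for the positive census.
-/

namespace Summit.AtomisticToContinuum.Crystallization.Theorems.ShellTrichotomyNegative

open Literature.Geometry.DiscreteGeometry Literature.Geometry.DiscreteGeometry.ShellCensus

/-! ## Generic tools: clique count under relabelling, link closure, two arccos brackets -/

/-- Number of bonded 3-cliques of a Bool relation on twelve labels. [folklore] -/
def cliqueCount (g : Fin 12 → Fin 12 → Bool) : ℕ :=
  (((Finset.univ : Finset (Fin 12)).powersetCard 3).filter
    fun S => ∀ v ∈ S, ∀ w ∈ S, v ≠ w → g v w = true).card

/-- The 3-clique count is invariant under relabelling (the obstruction used against all three disjuncts). [folklore] -/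
theorem cliqueCount_relabel (g P : Fin 12 → Fin 12 → Bool) (σ : Equiv.Perm (Fin 12))
    (h : ∀ v w, v ≠ w → (g (σ v) (σ w) = true ↔ P v w = true)) : cliqueCount g = cliqueCount P := by
  classical
  unfold cliqueCount
  symm
  refine Finset.card_bij (fun S _ => S.map σ.toEmbedding) ?_ ?_ ?_
  · intro S hS
    rw [Finset.mem_filter, Finset.mem_powersetCard] at hS ⊢
    refine ⟨⟨Finset.subset_univ _, by rw [Finset.card_map]; exact hS.1.2⟩, ?_⟩
    intro v hv w hw hvw
    rw [Finset.mem_map] at hv hw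
    obtain ⟨a, ha, rfl⟩ := hv
    obtain ⟨b, hb, rfl⟩ := hw
    have hab : a ≠ b := fun e => hvw (by rw [e])
    exact (h a b hab).2 (hS.2 a ha b hb hab)
  · intro S _ S' _ hSS'
    exact Finset.map_injective _ hSS'
  · intro S' hS'
    refine ⟨S'.map σ.symm.toEmbedding, ?_, ?_⟩
    · rw [Finset.mem_filter, Finset.mem_powersetCard] at hS' ⊢
      refine ⟨⟨Finset.subset_univ _, by rw [Finset.card_map]; exact hS'.1.2⟩, ?_⟩
      intro a ha b hb hab
      rw [Finset.mem_map] at ha hb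
      obtain ⟨v, hv, rfl⟩ := ha
      obtain ⟨w, hw, rfl⟩ := hb
      have hvw : v ≠ w := fun e => hab (by rw [e])
      have hg := hS'.2 v hv w hw hvw
      refine (h _ _ ?_).1 ?_
      · simpa using hvw
      · simpa using hg
    · rw [Finset.map_map]
      convert Finset.map_refl (s := S')
      ext x
      simp

/-- Bitmask key of a label set (for table lookups). [folklore] -/
def triKey (S : Finset (Fin 12)) : ℕ := ∑ i ∈ S, 2 ^ (i : ℕ)

/-- From an index-quantified fact about a list to its members (index quantification `∀ i < l.length` is what
`decide` should see: a bare `∀ S ∈ l` over `Finset (Fin 12)` resolves through `Fintype (Finset (Fin 12))` and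
enumerates all 4096 label sets in the kernel). [folklore] -/
theorem forall_mem_of_forall_getD {l : List (Finset (Fin 12))} {P : Finset (Fin 12) → Prop}
    (h : ∀ i < l.length, P (l.getD i ∅)) : ∀ S ∈ l, P S := by
  intro S hS
  obtain ⟨i, hi, rfl⟩ := List.mem_iff_getElem.1 hS
  have hP := h i hi
  rwa [List.getD_eq_getElem _ _ hi] at hP

/-- Flag-connectedness of all links from explicit chains: for every label `v` a list of triangles of
`tri` at `v` containing the whole star of `v`, consecutive members sharing a side. [folklore] -/
theorem link_of_chain (tri : Finset (Finset (Fin 12))) (ord : Fin 12 → List (Finset (Fin 12)))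
    (hmem : ∀ v, ∀ S ∈ tri, v ∈ S → S ∈ ord v)
    (htri : ∀ v, ∀ S ∈ ord v, S ∈ tri ∧ v ∈ S)
    (hchain : ∀ v, ∀ i < (ord v).length - 1, ((ord v).getD i ∅ ∩ (ord v).getD (i + 1) ∅).card = 2) :
    ∀ v, ∀ A ⊆ tri.filter (fun S => v ∈ S), A.Nonempty →
      (∀ S ∈ A, ∀ S' ∈ tri, v ∈ S' → (S ∩ S').card = 2 → S' ∈ A) → A = tri.filter fun S => v ∈ S := by
  intro v A hA hne hcl
  obtain ⟨S₀, hS₀⟩ := hne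
  refine Finset.Subset.antisymm hA ?_
  have getD_mem : ∀ i, i < (ord v).length → (ord v).getD i ∅ ∈ ord v := fun i hi => by
    rw [List.getD_eq_getElem _ _ hi]; exact List.getElem_mem hi
  have hS₀' := Finset.mem_filter.1 (hA hS₀)
  obtain ⟨i₀, hi₀, hli₀⟩ := List.mem_iff_getElem.1 (hmem v S₀ hS₀'.1 hS₀'.2)
  have h0 : (ord v).getD i₀ ∅ = S₀ := by rw [List.getD_eq_getElem _ _ hi₀]; exact hli₀
  have fwd : ∀ k, i₀ + k < (ord v).length → (ord v).getD (i₀ + k) ∅ ∈ A := by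
    intro k
    induction k with
    | zero => intro _; rw [Nat.add_zero, h0]; exact hS₀
    | succ k ih =>
      intro hk
      have h1 := ih (by omega)
      have hc := hchain v (i₀ + k) (by omega)
      have ht := htri v _ (getD_mem (i₀ + (k + 1)) hk)
      rw [show i₀ + (k + 1) = i₀ + k + 1 from by omega] at ht ⊢
      exact hcl _ h1 _ ht.1 ht.2 hc
  have bwd : ∀ k, k ≤ i₀ → (ord v).getD (i₀ - k) ∅ ∈ A := by
    intro k
    induction k with
    | zero => intro _; rw [Nat.sub_zero, h0]; exact hS₀
    | succ k ih =>
      intro hk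
      have h1 := ih (by omega)
      have hc := hchain v (i₀ - (k + 1)) (by omega)
      rw [show i₀ - (k + 1) + 1 = i₀ - k from by omega, Finset.inter_comm] at hc
      have ht := htri v _ (getD_mem (i₀ - (k + 1)) (by omega))
      exact hcl _ h1 _ ht.1 ht.2 hc
  intro S' hS'
  rw [Finset.mem_filter] at hS'
  obtain ⟨j, hj, hlj⟩ := List.mem_iff_getElem.1 (hmem v S' hS'.1 hS'.2)
  have hj' : (ord v).getD j ∅ = S' := by rw [List.getD_eq_getElem _ _ hj]; exact hlj
  rw [← hj']
  rcases le_or_gt i₀ j with hij | hij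
  · have h := fwd (j - i₀) (by omega)
    rwa [show i₀ + (j - i₀) = j from by omega] at h
  · have h := bwd (i₀ - j) (by omega)
    rwa [show i₀ - (i₀ - j) = j from by omega] at h

/-- `2π/5 ≤ arccos (1/4)` (so a `72°` corner obeys the T bound). [folklore] -/
theorem two_pi_div_five_le_arccos_quarter : 2 * Real.pi / 5 ≤ Real.arccos (1 / 4) := by
  have h0 : 2 * Real.pi / 5 = 2 * (Real.pi / 5) := by ring
  have hc : Real.cos (2 * Real.pi / 5) = (Real.sqrt 5 - 1) / 4 := by rw [h0]; exact cos_two_pi_div_five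
  have h5 : (2 : ℝ) ≤ Real.sqrt 5 := by
    have hs := Real.sq_sqrt (show (0 : ℝ) ≤ 5 by norm_num)
    nlinarith [Real.sqrt_nonneg 5]
  have e : Real.arccos (Real.cos (2 * Real.pi / 5)) = 2 * Real.pi / 5 :=
    Real.arccos_cos (by positivity) (by linarith [Real.pi_pos])
  rw [← e]
  exact Real.arccos_le_arccos (by rw [hc]; linarith)

/-- `π/3 ≤ arccos (807/2000)` (so a `60°` corner obeys the H bound and `120°` the Q bound). [folklore] -/
theorem pi_div_three_le_arccos : Real.pi / 3 ≤ Real.arccos (807 / 2000) := by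
  have e : Real.arccos (Real.cos (Real.pi / 3)) = Real.pi / 3 :=
    Real.arccos_cos (by positivity) (by linarith [Real.pi_pos])
  rw [← e, Real.cos_pi_div_three]
  exact Real.arccos_le_arccos (by norm_num)

/-- The fcc adjacency as a Bool relation. [folklore] -/
def fccAdjB (v w : Fin 12) : Bool := decide (sqNormInt (fccVec v - fccVec w) = 2)
/-- The hcp adjacency as a Bool relation. [folklore] -/
def hcpAdjB (v w : Fin 12) : Bool := decide (sqNormInt (hcpVec v - hcpVec w) = 18)
/-- The labelled hexagonal-antiprism adjacency of `stub_censusCore`'s third disjunct. [folklore] -/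
def antiAdjB (v w : Fin 12) : Bool :=
  decide ((min v.val w.val, max v.val w.val) ∈ ([(0, 1), (1, 2), (2, 3), (3, 4), (4, 5), (0, 5), (6, 7), (7, 8), (8, 9), (9, 10), (10, 11), (6, 11), (0, 6), (1, 7), (2, 8), (3, 9), (4, 10), (5, 11), (1, 6), (2, 7), (3, 8), (4, 9), (5, 10), (0, 11)] : List (ℕ × ℕ)))

/-- the labelled fcc graph has eight bonded triangles. [folklore] -/
theorem cliqueCount_fcc : cliqueCount fccAdjB = 8 := by decide +kernel
/-- the labelled hcp graph has eight bonded triangles. [folklore] -/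
theorem cliqueCount_hcp : cliqueCount hcpAdjB = 8 := by decide +kernel
/-- the labelled hexagonal antiprism has twelve bonded triangles. [folklore] -/
theorem cliqueCount_anti : cliqueCount antiAdjB = 12 := by decide +kernel

/-- The common final step: a bond relation with a 3-clique count other than `8` and `12` matches none of the
three labelled targets under any relabelling. [folklore] -/
theorem no_target_of_cliqueCount (bond : Fin 12 → Fin 12 → Bool) (hc8 : cliqueCount bond ≠ 8)
    (hc12 : cliqueCount bond ≠ 12) :
    ¬ ∃ σ : Equiv.Perm (Fin 12),
      (∀ v w, v ≠ w → (bond (σ v) (σ w) = true ↔ sqNormInt (fccVec v - fccVec w) = 2)) ∨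
      (∀ v w, v ≠ w → (bond (σ v) (σ w) = true ↔ sqNormInt (hcpVec v - hcpVec w) = 18)) ∨
      (∀ v w, bond (σ v) (σ w) = true ↔ (min v.val w.val, max v.val w.val) ∈
        ([(0, 1), (1, 2), (2, 3), (3, 4), (4, 5), (0, 5), (6, 7), (7, 8), (8, 9), (9, 10), (10, 11), (6, 11), (0, 6), (1, 7), (2, 8), (3, 9), (4, 10), (5, 11), (1, 6), (2, 7), (3, 8), (4, 9), (5, 10), (0, 11)] : List (ℕ × ℕ))) := by
  rintro ⟨σ, h | h | h⟩
  · refine hc8 ?_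
    rw [← cliqueCount_fcc]
    exact cliqueCount_relabel bond fccAdjB σ fun v w hvw => (h v w hvw).trans (by simp [fccAdjB])
  · refine hc8 ?_
    rw [← cliqueCount_hcp]
    exact cliqueCount_relabel bond hcpAdjB σ fun v w hvw => (h v w hvw).trans (by simp [hcpAdjB])
  · refine hc12 ?_
    rw [← cliqueCount_anti]
    exact cliqueCount_relabel bond antiAdjB σ fun v w _ => (h v w).trans (by simp [antiAdjB])


end Summit.AtomisticToContinuum.Crystallization.Theorems.ShellTrichotomyNegative
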